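import Summits.Langlands.Langlands.Theses.PhantomRMYoshida
import Summits.Langlands.Langlands.Theorems.PhantomRMYoshidaFaltingsTateModuleQ

/-!
# Route PhantomRMYoshida — the gate `FaltingsTateModuleQ` (item stmt-Langlands-15085) by name

The route file `Summits/Langlands/Langlands/Theses/PhantomRMYoshida.lean` now declares the two
named-fact gates of the route-choice repair of 2026-08-16 as route decls:

* `FaltingsTateModuleQ` (item stmt-Langlands-15085) — Faltings' Tate-module theorems over `ℚ`:
  for every prime `p` and every abelian variety `B/ℚ`, (i) the Tate map
  `ℤ_p ⊗_ℤ End_ℚ(B) → End_{Γ_ℚ}(T_p B)`, `c ⊗ f ↦ c • T_p f`, is bijective (G. Faltings,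
  *Endlichkeitssätze für abelsche Varietäten über Zahlkörpern*, Invent. Math. 73 (1983), §5,
  Satz 4) and (ii) `V_p B` is a semisimple `ℚ_p[Γ_ℚ]`-module (ibid., Satz 3);
* `FaltingsFinitenessI` (item stmt-Langlands-15084) — Finiteness I over `ℚ`: up to isomorphism
  only finitely many `B/ℚ` are isogenous to a given `A/ℚ` (ibid., §6, Satz 6 with Zarhin's trick;
  J. S. Milne, *Abelian Varieties* (2008), Ch. IV, Thm. 1.1).

The sibling file `Theorems/PhantomRMYoshidaFaltingsTateModuleQ.lean` proved, against the items'
registered signatures spelled out verbatim (the decls did not exist yet), that the first gate is a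
consequence of the second in the tree (`faltingsTateModuleQ_of_faltingsFinitenessI`, through the
tree's sorry-free deduction of Faltings §5 from Finiteness I: Tate's lattice argument, quotients by
finite stable subgroups, Mumford §19 Thm. 3 from the Theorem of the Cube, Poincaré reducibility and
its Galois descent to `ℚ`) and that it is the conjunction over `ℚ` of the two Literature named
facts of hodge.S27 (`faltingsTateModuleQ_iff_hodgeS27`).

This file restates those links **against the route decls by name**, so that they can be cited
and composed literally:

* `faltingsTateModuleQ_of_finitenessI : FaltingsFinitenessI → FaltingsTateModuleQ` — the gate
  stmt-Langlands-15085 is DERIVED from the gate stmt-Langlands-15084; whatever closes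
  `FaltingsFinitenessI` closes `FaltingsTateModuleQ` by this theorem;
* `faltingsTateModuleQ_of_forall_finite_isoClasses_isogenous` — the same from the Literature named
  fact `AbelianVariety.finite_isoClasses_isogenous` over `ℚ` (the item's single outstanding input);
* `faltingsTateModuleQ_iff` — `FaltingsTateModuleQ ↔ (∀ p B, faltings_tate_bijective B B p) ∧
  (∀ p B, isSemisimpleRepresentation_rationalTateRep B p)`;
* the four projections consumed by the `p = 3` motivic line of crux `StableYoshidaCongruence`
  (stub `stub_tateModuleIrreducible`, whose first two hypotheses are exactly these Literature
  facts over `ℚ`) and by the conditional crux `StableYoshidaCongruenceModFaltings`: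
  `faltings_tate_bijective_of_faltingsTateModuleQ`,
  `isSemisimpleRepresentation_rationalTateRep_of_faltingsTateModuleQ`,
  `faltings_tate_bijective_of_finitenessI`,
  `isSemisimpleRepresentation_rationalTateRep_of_finitenessI`.

No statement is weakened: every theorem here is a re-binding of the sibling file's theorems to
the route decls (which unfold, by `rfl`, to the registered signatures).

## References

* [Faltings1983Endlichkeit] G. Faltings, Invent. Math. 73 (1983), 349–366, §5 Satz 3–4, §6 Satz 6.
* [Faltings1986FinitenessTranslation] Cornell–Silverman (eds.), *Arithmetic Geometry* (1986),
  Ch. II, §5 Theorems 3–4, §6 Theorem 6.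
* [MilneAV2008] J. S. Milne, *Abelian Varieties* (2008), Ch. IV, Thm. 1.1 and §2.
-/

set_option linter.dupNamespace false -- project-wide option; `Summit.Langlands.Langlands` is the mandated namespace (summit = sub-problem)

namespace Summit.Langlands.Langlands.Theorems.PhantomRMYoshida

open Summit.Langlands.Langlands.Theses.PhantomRMYoshida
open Literature.AlgebraicGeometry.Motives
open Literature.AlgebraicGeometry.Motives.AbelianVariety

/-- **The gate `FaltingsTateModuleQ` is derived from the gate `FaltingsFinitenessI`.** Finiteness I
over `ℚ` (route decl `FaltingsFinitenessI`, item stmt-Langlands-15084: Faltings, Invent. Math. 73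
(1983), §6, Satz 6 with Zarhin's trick; Milne, *Abelian Varieties* (2008), IV Thm. 1.1) implies
Faltings' Tate-module theorems over `ℚ` (route decl `FaltingsTateModuleQ`, item
stmt-Langlands-15085: ibid., §5, Satz 4 — bijectivity of `ℤ_p ⊗ End_ℚ(B) → End_{Γ_ℚ}(T_p B)` —
and Satz 3 — semisimplicity of `V_p B`), by the sibling theorem
`Theorems.faltingsTateModuleQ_of_faltingsFinitenessI` (the tree's deduction of §5 from
Finiteness I), both decls unfolding to the registered signatures by `rfl`. -/
theorem faltingsTateModuleQ_of_finitenessI (h : FaltingsFinitenessI) : FaltingsTateModuleQ :=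
  Summit.Langlands.Langlands.Theorems.faltingsTateModuleQ_of_faltingsFinitenessI h

/-- **`FaltingsTateModuleQ` from the Literature named fact Finiteness I over `ℚ`.** If
`AbelianVariety.finite_isoClasses_isogenous P` (Milne, *Abelian Varieties* (2008), IV Thm. 1.1;
Faltings 1983, §6) holds for every abelian variety `P/ℚ`, then the route decl
`FaltingsTateModuleQ` holds (Faltings 1983, §5, Satz 3–4), by the sibling theorem
`Theorems.faltingsTateModuleQ_of_finite_isoClasses_isogenous`. This names the item's single
outstanding input. -/
theorem faltingsTateModuleQ_of_forall_finite_isoClasses_isogenous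
    (hfin : ∀ P : AbelianVariety ℚ, finite_isoClasses_isogenous P) : FaltingsTateModuleQ :=
  Summit.Langlands.Langlands.Theorems.faltingsTateModuleQ_of_finite_isoClasses_isogenous hfin

/-- **`FaltingsTateModuleQ` is the conjunction over `ℚ` of the two hodge.S27 named facts**
`faltings_tate_bijective B B p` (Faltings 1983, §5, Satz 4 / Korollar 1 with `A₁ = A₂ = B`) and
`isSemisimpleRepresentation_rationalTateRep B p` (Satz 3) of
`Literature/AlgebraicGeometry/Motives/FaltingsAbelian`, for all primes `p` and all `B/ℚ`; their
`∀ [NumberField ℚ]` binders are discharged by `Rat.numberField` (sibling theorem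
`Theorems.faltingsTateModuleQ_iff_hodgeS27`). -/
theorem faltingsTateModuleQ_iff :
    FaltingsTateModuleQ ↔
      ((∀ (p : ℕ) [Fact p.Prime] (B : AbelianVariety ℚ), faltings_tate_bijective B B p) ∧
        (∀ (p : ℕ) [Fact p.Prime] (B : AbelianVariety ℚ),
          isSemisimpleRepresentation_rationalTateRep B p)) :=
  Summit.Langlands.Langlands.Theorems.faltingsTateModuleQ_iff_hodgeS27

/-- From the gate `FaltingsTateModuleQ`: the Literature named fact `faltings_tate_bijective B B p`
(Faltings 1983, §5, Satz 4: `ℤ_p ⊗ End_ℚ(B) → End_{Γ_ℚ}(T_p B)` is bijective) for every prime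
`p` and every abelian variety `B/ℚ` — the first fact hypothesis of the `p = 3` motivic line of
crux `StableYoshidaCongruence`. -/
theorem faltings_tate_bijective_of_faltingsTateModuleQ (h : FaltingsTateModuleQ) (p : ℕ)
    [Fact p.Prime] (B : AbelianVariety ℚ) : faltings_tate_bijective B B p :=
  (faltingsTateModuleQ_iff.1 h).1 p B

/-- From the gate `FaltingsTateModuleQ`: the Literature named fact
`isSemisimpleRepresentation_rationalTateRep B p` (Faltings 1983, §5, Satz 3: `V_p B` is a
semisimple `ℚ_p[Γ_ℚ]`-module) for every prime `p` and every abelian variety `B/ℚ` — the second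
fact hypothesis of the `p = 3` motivic line of crux `StableYoshidaCongruence`. -/
theorem isSemisimpleRepresentation_rationalTateRep_of_faltingsTateModuleQ
    (h : FaltingsTateModuleQ) (p : ℕ) [Fact p.Prime] (B : AbelianVariety ℚ) :
    isSemisimpleRepresentation_rationalTateRep B p :=
  (faltingsTateModuleQ_iff.1 h).2 p B

/-- From the gate `FaltingsFinitenessI` (Finiteness I over `ℚ`): the Literature named fact
`faltings_tate_bijective B B p` (Faltings 1983, §5, Satz 4) for every prime `p` and every `B/ℚ`
— the form in which the conditional crux `StableYoshidaCongruenceModFaltings` feeds the `p = 3`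
line (`intro hFin`, then this theorem discharges `stub_fact_faltingsTateBijective`). -/
theorem faltings_tate_bijective_of_finitenessI (h : FaltingsFinitenessI) (p : ℕ) [Fact p.Prime]
    (B : AbelianVariety ℚ) : faltings_tate_bijective B B p :=
  faltings_tate_bijective_of_faltingsTateModuleQ (faltingsTateModuleQ_of_finitenessI h) p B

/-- From the gate `FaltingsFinitenessI` (Finiteness I over `ℚ`): the Literature named fact
`isSemisimpleRepresentation_rationalTateRep B p` (Faltings 1983, §5, Satz 3) for every prime `p`
and every `B/ℚ` — discharges `stub_fact_faltingsSemisimple` of the `p = 3` line under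
`StableYoshidaCongruenceModFaltings`. -/
theorem isSemisimpleRepresentation_rationalTateRep_of_finitenessI (h : FaltingsFinitenessI)
    (p : ℕ) [Fact p.Prime] (B : AbelianVariety ℚ) :
    isSemisimpleRepresentation_rationalTateRep B p :=
  isSemisimpleRepresentation_rationalTateRep_of_faltingsTateModuleQ
    (faltingsTateModuleQ_of_finitenessI h) p B

end Summit.Langlands.Langlands.Theorems.PhantomRMYoshida

/-! ### The unconditional half of (i) and what exactly remains

Of the two clauses of `FaltingsTateModuleQ`, the INJECTIVITY of the Tate map
`ℤ_p ⊗_ℤ End_ℚ(B) → End_{Γ_ℚ}(T_p B)` is Mumford, *Abelian Varieties*, §19, Theorem 3 (second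
assertion), valid over any field for `p` invertible, and is a THEOREM of the tree
(`AbelianVariety.faltingsTateMap_injective_holds`, from the Theorem of the Cube
`theoremOfCube_linEquiv_holds`, `Literature/NumberTheory/DiophantineGeometry/AVIsogenyTateHoldsProofs`).
So the gate is equivalent to SURJECTIVITY of the Tate map (the content of Faltings' Satz 4
beyond Mumford §19) together with Satz 3. -/

namespace Summit.Langlands.Langlands.Theorems.PhantomRMYoshida

open Summit.Langlands.Langlands.Theses.PhantomRMYoshida
open Literature.AlgebraicGeometry.Motives
open Literature.AlgebraicGeometry.Motives.AbelianVariety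

/-- **Injectivity of the Tate map over `ℚ`, unconditionally** (Mumford, *Abelian Varieties*,
§19, Theorem 3, second assertion: `ℤ_ℓ ⊗ Hom(A, B) → Hom(T_ℓ A, T_ℓ B)` is injective for
`ℓ ≠ char K`): for every prime `p` and every abelian variety `B/ℚ` the Tate map
`faltingsTateMap B B p : ℤ_p ⊗_ℤ End_ℚ(B) → End_{Γ_ℚ}(T_p B)` is injective — the tree theorem
`AbelianVariety.faltingsTateMap_injective_holds` (Theorem of the Cube) at `K = ℚ`, where
`(p : ℚ) ≠ 0`. This is the half of clause (i) of `FaltingsTateModuleQ` that does not need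
Faltings. -/
theorem faltingsTateMap_end_injective_rat (p : ℕ) [Fact p.Prime] (B : AbelianVariety ℚ) :
    Function.Injective (faltingsTateMap B B p) :=
  faltingsTateMap_injective_holds B B p (Nat.cast_ne_zero.2 (Fact.out : p.Prime).ne_zero)

/-- **What remains of `FaltingsTateModuleQ` after Mumford §19 Thm. 3.** The gate holds iff, for
every prime `p` and every abelian variety `B/ℚ`, (i′) the Tate map
`ℤ_p ⊗_ℤ End_ℚ(B) → End_{Γ_ℚ}(T_p B)` is SURJECTIVE (every `Γ_ℚ`-equivariant `ℤ_p`-endomorphism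
of `T_p B` is a `ℤ_p`-combination of endomorphisms of `B`; Faltings 1983, §5, Satz 4) and (ii)
`V_p B` is a semisimple `ℚ_p[Γ_ℚ]`-module (Satz 3) — injectivity being the unconditional
`faltingsTateMap_end_injective_rat`. Both remaining clauses are, in the tree, consequences of
Finiteness I alone (`faltingsTateModuleQ_of_finitenessI`). -/
theorem faltingsTateModuleQ_iff_surjective_and_isSemisimple :
    FaltingsTateModuleQ ↔
      ((∀ (p : ℕ) [Fact p.Prime] (B : AbelianVariety ℚ),
          Function.Surjective (faltingsTateMap B B p)) ∧
        (∀ (p : ℕ) [Fact p.Prime] (B : AbelianVariety ℚ),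
          (rationalTateRep B p).IsSemisimpleRepresentation)) := by
  unfold FaltingsTateModuleQ
  constructor
  · rintro ⟨h1, h2⟩
    exact ⟨fun p _ B ↦ (h1 p B).2, fun p _ B ↦ h2 p B⟩
  · rintro ⟨h1, h2⟩
    exact ⟨fun p _ B ↦ ⟨faltingsTateMap_end_injective_rat p B, h1 p B⟩, fun p _ B ↦ h2 p B⟩

end Summit.Langlands.Langlands.Theorems.PhantomRMYoshida

/-! ### What the gate buys: the whole of Faltings 1983, §5 over `ℚ`

`FaltingsTateModuleQ` is typed in the `End` form of Satz 4 (the Tate map for `End_ℚ(B)`) plus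
Satz 3. Faltings' proof of Korollar 1 ("Theorem 4 applied to `A₁ × A₂`") and of Korollar 2
("the equivalence of (i) and (ii) follows from Theorem 4", Tate's lattice argument) are theorems
of the tree over any number field (`forall_faltings_tate_bijective_iff_forall_end`,
`isIsogenous_iff_nonempty_equiv_rationalTateRep_of_forall_faltings_tate_bijective`,
`Literature/AlgebraicGeometry/Motives/FaltingsAbelianProofs`, `…FaltingsAbelianIsogenyProofs`), so
the gate alone yields, over `ℚ`, the `Hom` form of hodge.S27 for every pair and Faltings' isogeny
theorem — i.e. the gate is EQUIVALENT to the full named-fact package hodge.S27 over `ℚ`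
(`faltingsTateModuleQ_iff_hodgeS27_hom`). Whatever closes item stmt-Langlands-15085 therefore
discharges every consumer of `faltings_tate_bijective X Y p` /
`isIsogenous_iff_nonempty_equiv_rationalTateRep X Y p` at `K = ℚ`, not only the `End`-form
instances used by the `p = 3` line of crux `StableYoshidaCongruence`. (Appended 2026-08-16;
everything above is unchanged.) -/

namespace Summit.Langlands.Langlands.Theorems.PhantomRMYoshida

open CategoryTheory CategoryTheory.Limits
open Summit.Langlands.Langlands.Theses.PhantomRMYoshida
open Literature.AlgebraicGeometry.Motives
open Literature.AlgebraicGeometry.Motives.AbelianVariety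

/-- **Korollar 1 over `ℚ` from the gate** (Faltings, Invent. Math. 73 (1983), §5, Korollar 1:
`ℤ_p ⊗ Hom_ℚ(X, Y) → Hom_{Γ_ℚ}(T_p X, T_p Y)` is bijective for EVERY pair of abelian varieties
over `ℚ`; proof as printed, "Theorem 4 applied to `A₁ × A₂`": the `End` form for `X ⊞ Y` given by
the gate, restricted to the corner `Hom(X, Y)` by the tree theorem
`forall_faltings_tate_bijective_iff_forall_end`). -/
theorem faltings_tate_bijective_hom_of_faltingsTateModuleQ (h : FaltingsTateModuleQ) (p : ℕ)
    [Fact p.Prime] (X Y : AbelianVariety ℚ) : faltings_tate_bijective X Y p :=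
  (forall_faltings_tate_bijective_iff_forall_end p).2
    (fun P ↦ faltings_tate_bijective_of_faltingsTateModuleQ h p P) X Y

/-- **Korollar 1 over `ℚ` from the gate, unfolded**: for every prime `p` and all abelian
varieties `X`, `Y` over `ℚ` the Tate map `faltingsTateMap X Y p : ℤ_p ⊗_ℤ Hom_ℚ(X, Y) →
Hom_{Γ_ℚ}(T_p X, T_p Y)` is bijective (Faltings 1983, §5, Korollar 1), the `[NumberField ℚ]`
binder of the named fact being `Rat.numberField`. -/
theorem bijective_faltingsTateMap_hom_of_faltingsTateModuleQ (h : FaltingsTateModuleQ) (p : ℕ)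
    [Fact p.Prime] (X Y : AbelianVariety ℚ) : Function.Bijective (faltingsTateMap X Y p) :=
  faltings_tate_bijective_hom_of_faltingsTateModuleQ h p X Y

/-- **Faltings' isogeny theorem over `ℚ` from the gate** (Invent. Math. 73 (1983), §5,
Korollar 2, (i) ⇔ (ii)): for every prime `p`, two abelian varieties `X`, `Y` over `ℚ` are
`ℚ`-isogenous iff `V_p X ≅ V_p Y` as `ℚ_p[Γ_ℚ]`-modules — the named fact
`isIsogenous_iff_nonempty_equiv_rationalTateRep X Y p`, by the tree's deduction of Korollar 2
from Korollar 1 for the four pairs `(X, Y)`, `(Y, X)`, `(X, X)`, `(Y, Y)` (Tate's lattice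
argument, `isIsogenous_iff_nonempty_equiv_rationalTateRep_of_forall_faltings_tate_bijective`)
applied to `faltings_tate_bijective_hom_of_faltingsTateModuleQ`. -/
theorem isIsogenous_iff_nonempty_equiv_rationalTateRep_of_faltingsTateModuleQ
    (h : FaltingsTateModuleQ) (p : ℕ) [Fact p.Prime] (X Y : AbelianVariety ℚ) :
    isIsogenous_iff_nonempty_equiv_rationalTateRep X Y p :=
  isIsogenous_iff_nonempty_equiv_rationalTateRep_of_forall_faltings_tate_bijective X Y p
    (faltings_tate_bijective_hom_of_faltingsTateModuleQ h p)

/-- **Faltings' isogeny theorem over `ℚ` from the gate, unfolded**: granted `FaltingsTateModuleQ`,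
for every prime `p` and all abelian varieties `X`, `Y` over `ℚ`,
`IsIsogenous X Y ↔ Nonempty ((X.rationalTateRep p).Equiv (Y.rationalTateRep p))`
(Faltings 1983, §5, Korollar 2, (i) ⇔ (ii); `Rat.numberField` discharges the fact's binder). -/
theorem isIsogenous_iff_of_faltingsTateModuleQ (h : FaltingsTateModuleQ) (p : ℕ) [Fact p.Prime]
    (X Y : AbelianVariety ℚ) :
    IsIsogenous X Y ↔ Nonempty ((X.rationalTateRep p).Equiv (Y.rationalTateRep p)) :=
  isIsogenous_iff_nonempty_equiv_rationalTateRep_of_faltingsTateModuleQ h p X Y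

/-- **The gate is the whole of hodge.S27 over `ℚ`.** `FaltingsTateModuleQ` (Satz 4 in `End` form
∧ Satz 3, for all primes and all abelian varieties over `ℚ`) is equivalent to the conjunction of
the Literature named facts `faltings_tate_bijective X Y p` for ALL pairs (Korollar 1) and
`isSemisimpleRepresentation_rationalTateRep B p` (Satz 3) over `ℚ`: `⇒` by
`faltings_tate_bijective_hom_of_faltingsTateModuleQ`, `⇐` by specialising to `X = Y`
(`faltingsTateModuleQ_iff`). -/
theorem faltingsTateModuleQ_iff_hodgeS27_hom :
    FaltingsTateModuleQ ↔
      ((∀ (p : ℕ) [Fact p.Prime] (X Y : AbelianVariety ℚ), faltings_tate_bijective X Y p) ∧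
        (∀ (p : ℕ) [Fact p.Prime] (B : AbelianVariety ℚ),
          isSemisimpleRepresentation_rationalTateRep B p)) := by
  refine ⟨fun h ↦ ⟨fun p _ X Y ↦ faltings_tate_bijective_hom_of_faltingsTateModuleQ h p X Y,
    fun p _ B ↦ isSemisimpleRepresentation_rationalTateRep_of_faltingsTateModuleQ h p B⟩,
    fun h ↦ faltingsTateModuleQ_iff.2 ⟨fun p _ B ↦ h.1 p B B, h.2⟩⟩

end Summit.Langlands.Langlands.Theorems.PhantomRMYoshida
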